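import Summits.ResolutionOfSingularities.ResolutionOfSingularities.Theorems.MarkedTransferCampaignW12SandwichFrobeniusConstants
import Mathlib.Algebra.MvPolynomial.PDeriv
import Mathlib.RingTheory.MvPolynomial.Basic
import Mathlib.RingTheory.MvPolynomial.Ideal
import Mathlib.Algebra.CharP.Two
import Mathlib.Data.ZMod.Basic
import Mathlib.Algebra.Field.ZMod
import HarnessLib

/-!
# [OURS · L1 W1.2 · K1.2 blind reproduction, part 1] The sandwich negative module on the R05 #1 witness
# `W2 = ((y² + yω₁⁵ω₂ + yω₁ω₂ + ω₁⁴), 2) ⊂ 𝔸³`, `p = 2`, `ξ = 0`, `q = m = 2`, `e = 1` (seat res-L1-k11, gen 2)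

LADDER-RESOLUTION rung L (rescue), cell `res-hironaka` (run/shared/lean/pub/res-hironaka/), slot **W1.2**
(FROBENIUS-SANDWICH differential operators). This file is an INDEPENDENT («blind») re-derivation, by the seat
res-L1-k11 (re-pointed by director-resolution 2026-08-26T19:49:45Z (c) / res-L1-dag-5 19:52:37Z), of one of the three
witnesses of res-L1-k12's registered kill test K1.2 (HOME/STATUS.md 2026-08-26T19:41:04Z, read verbatim; nothing
else of k12's was read). Object: the typed `Campaign.sandwichPNega p e P m a` (res-L1-type-o2, p461383) — Def 5.1's
`℘nega(E,−a)` with the differential operators of `O` taken RELATIVE TO `ρ^e(O)`; structural lemmas from res-L1-s12-pv-1's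
`MarkedTransferCampaignW12SandwichFrobeniusConstants.lean` (`W12.not_sandwichPNega_le`, `W12.diffIdeal_le_span`).
PROOFS ONLY — no new objects (the witness polynomial is written out in every statement).

HONEST FRAMING. Nothing here is a statement of H. Hironaka's manuscript *Resolution of singularities in positive
characteristics* (2017-03-23, [Hironaka2017], lit key `paper:url-3343fd9e678b`); the characteristic algebra `℘(E)`
enters ONLY as an abstract family `P : ℕ → Ideal O` with the single explicit hypothesis `g ∈ P 2` (Th 4.1 (1) p.17
l.22 «`J ⊂ ℘(E,b)`», a CANDIDATE [claim: Hironaka2017, status: under-review] consumed as a hypothesis). Ring level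
`O = 𝔽₂[y, ω₁, ω₂]` (`Fin 3`: `0 = y`, `1 = ω₁`, `2 = ω₂`), `𝔪_ξ = ker(constantCoeff)` the ideal of the origin; an
ideal `I ⊄ 𝔪_ξ` of `O` generates the unit ideal of `O_{𝔪_ξ}`. No verdict on K1.2 (res-L1-k12 scores it) and no verdict
on GAP-LEDGER rows R01 / R05 / R08 is implied: kernel facts about the OURS re-based object only. AI proof is weaker than
expert review; nothing here is progress on resolution of singularities in positive characteristic.

## What is proved (all sorry-free)
* §0 `sandwichPNega_le_span_of_multiples` — the no-unit direction needs a bound ONLY on the pieces `℘(E, n·m)`, `n ≥ 1`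
  (the summands of Eq. (36) never see `℘(E,j)` for `m ∤ j`); variant of `W12.sandwichPNega_le_span`.
* §1 In characteristic `2`, every partial derivative `∂_i` of a polynomial ring is `ρ(O)`-LINEAR (`∂_i(u²f) = u²∂_i f`),
  hence a differential operator of `O/ρ(O)` of order `≤ 1`; a triple mixed partial has order `≤ 3`
  (`exists_sandwich_pderiv`, `exists_sandwich_pderiv3`).
* §2 On `W2`: `∂_y∂_{ω₁}∂_{ω₂} g = 5ω₁⁴ + 1` has constant term `1`, so for EVERY family `P` with `g ∈ P 2`,
  `¬ sandwichPNega 2 1 P 2 a ≤ 𝔪_ξ` for `a = 1` and `a = 2` (`d = 1`, order `3 ≤ d·m + a`), and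
  `℘nega_sandwich(W2,−1) + 𝔪_ξ = O` — the DEAD-type certificate shape of the K1.2 registration («an explicit
  `f ∈ ℘(E,dm)` and an explicit `ρ^e(O)`-linear operator of order `≤ dm+a` give `D f ∉ 𝔪_ξ`»), met by `f = g` itself:
  the box monomial `yω₁ω₂` (all exponents `< q`) occurs in `g` with `ρ(O)`-coefficient `1 + ω₁⁴`, a unit at `ξ`.
-/

noncomputable section

set_option linter.dupNamespace false -- mandated namespace of this single-conjunct summit

namespace Summit.ResolutionOfSingularities.ResolutionOfSingularities.Theorems.Campaign.K11Repro

open MvPolynomial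
open Literature.AlgebraicGeometry.Resolution
open Literature.AlgebraicGeometry.Hironaka2017
open Summit.ResolutionOfSingularities.ResolutionOfSingularities.Theorems.Campaign

/-! ## §0 The no-unit direction only needs the multiples `℘(E, n·m)`, `n ≥ 1` -/

section General

universe v

variable {O : Type v} [CommRing O] (p : ℕ) [Fact p.Prime] [CharP O p]

/-- **`℘nega_sandwich(E,−a) ⊆ Q` from a bound on the multiples only.** If `Q = span S` with `S ⊆ ρ^e(O)` and
`℘(E, n·m) ⊆ Q` for every `n ≥ 1`, then `sandwichPNega p e P m a ≤ Q` for every `a : ℕ` (the summand `D(m,a,d)` of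
Eq. (36) is `Diff^{(dm+a)}_{O/ρ^e(O)}·℘posi(E,dm)`, and `℘posi(E,0) = 0`). Unlike `W12.sandwichPNega_le_span` no bound
on `℘(E,j)` for `m ∤ j` is asked (for the K1.2 witnesses `℘(E,1) ⊄ 𝔪_ξ^{[2]}` is expected, e.g. `yw` for `W1`).
[folklore] -/
theorem sandwichPNega_le_span_of_multiples (e : ℕ) {S : Set O} (hS : S ⊆ Set.range (iterateFrobenius O p e))
    {P : ℕ → Ideal O} {m : ℕ} (hP : ∀ n : ℕ, 0 < n → P (n * m) ≤ Ideal.span S) (a : ℕ) :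
    sandwichPNega p e P m a ≤ Ideal.span S := by
  unfold sandwichPNega S05NegativePart.pNega S05NegativePart.pTildeNeg
  refine iSup₂_le fun d _ => ?_
  unfold S05NegativePart.DD
  refine W12.diffIdeal_le_span e _ hS ?_
  unfold S05NegativePart.pPosi
  split_ifs with h
  · exact bot_le
  · have hd : 0 ≤ d := by
      by_contra hneg
      apply h
      exact Int.toNat_eq_zero.mpr (Int.mul_nonpos_of_nonpos_of_nonneg (le_of_not_ge hneg) (by positivity))
    obtain ⟨n, rfl⟩ := Int.eq_ofNat_of_zero_le hd
    have hcast : ((n : ℤ) * (m : ℤ)).toNat = n * m := by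
      rw [show ((n : ℤ) * (m : ℤ)) = ((n * m : ℕ) : ℤ) by push_cast; ring, Int.toNat_natCast]
    rw [hcast] at h ⊢
    refine hP n (Nat.pos_of_ne_zero ?_)
    rintro rfl
    exact h (by simp)

/-- … hence `℘nega_sandwich(E,−a) ⊆ M` for all `a`, and `Campaign.SandwichNegaNoUnit p e P m`, as soon as
`span S ≤ M ≠ O`. [folklore] -/
theorem sandwichNegaNoUnit_of_multiples (e : ℕ) {S : Set O} (hS : S ⊆ Set.range (iterateFrobenius O p e))
    {M : Ideal O} (hSM : Ideal.span S ≤ M) (hM : M ≠ ⊤)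
    {P : ℕ → Ideal O} {m : ℕ} (hP : ∀ n : ℕ, 0 < n → P (n * m) ≤ Ideal.span S) :
    (∀ a : ℕ, sandwichPNega p e P m a ≤ M) ∧ SandwichNegaNoUnit p e P m :=
  have h : ∀ a : ℕ, sandwichPNega p e P m a ≤ M :=
    fun a => (sandwichPNega_le_span_of_multiples p e hS hP a).trans hSM
  ⟨h, fun a _ ha1 => hM ((Ideal.eq_top_iff_one M).mpr (h a ha1))⟩

end General

/-! ## §1 Characteristic `2`: partial derivatives are sandwich operators of order `≤ 1` -/

section CharTwoPDeriv

variable {σ : Type*} {R : Type*} [CommRing R] [CharP R 2]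

/-- `p = 2`: `∂_i (u² f) = u² ∂_i f` in `R[X_σ]`, `char R = 2`. [folklore] -/
theorem pderiv_sq_mul (i : σ) (u f : MvPolynomial σ R) : pderiv i (u ^ 2 * f) = u ^ 2 * pderiv i f := by
  rw [pderiv_mul, pderiv_pow]
  have h2 : (2 : MvPolynomial σ R) = 0 := CharTwo.two_eq_zero
  simp [h2]

/-- **`∂_i` is a sandwich operator of order `≤ 1`.** In characteristic `2` the partial derivative `∂_i` is LINEAR over
`ρ(O) = O²` (`O = R[X_σ]`), i.e. it is (the underlying map of) an `ρ(O)`-linear endomorphism `L` of `O`, and `L` is a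
differential operator of `O/ρ(O)` of order `≤ 1` (`[L, a] = (∂_i a)·`, EGA IV₄ 16.8.8 (b)). [folklore] -/
theorem exists_sandwich_pderiv (i : σ) :
    ∃ L : MvPolynomial σ R →ₗ[↥(iterateFrobenius (MvPolynomial σ R) 2 1).range] MvPolynomial σ R,
      IsDiffOpLE (↥(iterateFrobenius (MvPolynomial σ R) 2 1).range) 1 L ∧ ∀ f, L f = pderiv i f := by
  let L : MvPolynomial σ R →ₗ[↥(iterateFrobenius (MvPolynomial σ R) 2 1).range] MvPolynomial σ R :=
    { toFun := fun f => pderiv i f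
      map_add' := fun f g => map_add _ f g
      map_smul' := fun r f => by
        obtain ⟨u, hu⟩ := RingHom.mem_range.mp r.2
        have hr : (r : MvPolynomial σ R) = u ^ 2 := by rw [← hu, iterateFrobenius_def, pow_one]
        change pderiv i ((r : MvPolynomial σ R) * f) = (r : MvPolynomial σ R) * pderiv i f
        rw [hr]
        exact pderiv_sq_mul i u f }
  refine ⟨L, fun a => ?_, fun f => rfl⟩
  have h : commMul (↥(iterateFrobenius (MvPolynomial σ R) 2 1).range) L a =
      LinearMap.mulLeft (↥(iterateFrobenius (MvPolynomial σ R) 2 1).range) (pderiv i a) := by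
    refine LinearMap.ext fun t => ?_
    simp only [commMul_apply, LinearMap.mulLeft_apply]
    change pderiv i (a * t) - a * pderiv i t = pderiv i a * t
    rw [pderiv_mul]
    ring
  rw [h]
  exact isDiffOpLE_mulLeft _

/-- A triple mixed partial `∂_i ∂_j ∂_k` is a sandwich operator of order `≤ 3` (orders add, EGA IV₄ 16.8.9).
[folklore] -/
theorem exists_sandwich_pderiv3 (i j k : σ) :
    ∃ D : MvPolynomial σ R →ₗ[↥(iterateFrobenius (MvPolynomial σ R) 2 1).range] MvPolynomial σ R,
      IsDiffOpLE (↥(iterateFrobenius (MvPolynomial σ R) 2 1).range) 3 D ∧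
        ∀ f, D f = pderiv i (pderiv j (pderiv k f)) := by
  obtain ⟨Li, hi, hi'⟩ := exists_sandwich_pderiv (R := R) i
  obtain ⟨Lj, hj, hj'⟩ := exists_sandwich_pderiv (R := R) j
  obtain ⟨Lk, hk, hk'⟩ := exists_sandwich_pderiv (R := R) k
  exact ⟨Li ∘ₗ Lj ∘ₗ Lk, hi.comp (hj.comp hk), fun f => by simp [hi', hj', hk']⟩

end CharTwoPDeriv

/-! ## §2 The witness `W2`: a box monomial with unit `ρ(O)`-coefficient inside `g` itself -/

section W2

/-- `𝔪_ξ = ker(constantCoeff)` is a maximal ideal of `𝔽₂[X_σ]` (`O/𝔪_ξ ≅ 𝔽₂`): the ideal of the origin `ξ = 0`.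
[folklore] -/
theorem ker_constantCoeff_isMaximal (σ : Type*) :
    (RingHom.ker (constantCoeff : MvPolynomial σ (ZMod 2) →+* ZMod 2)).IsMaximal :=
  RingHom.ker_isMaximal_of_surjective (constantCoeff : MvPolynomial σ (ZMod 2) →+* ZMod 2) fun r =>
    ⟨C r, constantCoeff_C (σ := σ) r⟩

/-- The value `∂_y ∂_{ω₁} ∂_{ω₂} g = 5·ω₁⁴ + 1` (`= ω₁⁴ + 1` in characteristic `2`) on
`g = y² + yω₁⁵ω₂ + yω₁ω₂ + ω₁⁴ ∈ 𝔽₂[y, ω₁, ω₂]` (`Fin 3`: `0 = y`, `1 = ω₁`, `2 = ω₂`; the generator of `W2 = (g,2)`,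
`ord_ξ g = 2 = m = q`; the same polynomial as `y² + ε` of the tree's `Hironaka2017.DiffProduct`). [folklore] -/
theorem W2_pderiv3_g :
    pderiv 0 (pderiv 1 (pderiv 2
      (X 0 ^ 2 + X 0 * X 1 ^ 5 * X 2 + X 0 * X 1 * X 2 + X 1 ^ 4 : MvPolynomial (Fin 3) (ZMod 2)))) =
      5 * X 1 ^ 4 + 1 := by
  simp only [map_add, pderiv_mul, pderiv_pow, pderiv_X_self,
    pderiv_X_of_ne (show (0 : Fin 3) ≠ 2 by decide), pderiv_X_of_ne (show (1 : Fin 3) ≠ 2 by decide),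
    pderiv_X_of_ne (show (0 : Fin 3) ≠ 1 by decide), pderiv_X_of_ne (show (2 : Fin 3) ≠ 1 by decide),
    pderiv_X_of_ne (show (1 : Fin 3) ≠ 0 by decide), pderiv_X_of_ne (show (2 : Fin 3) ≠ 0 by decide),
    Derivation.map_natCast]
  norm_num

/-- … so its constant term is `1`: `∂_y∂_{ω₁}∂_{ω₂} g ∉ 𝔪_ξ` (a unit at `ξ`). [folklore] -/
theorem W2_pderiv3_g_not_mem :
    pderiv 0 (pderiv 1 (pderiv 2
      (X 0 ^ 2 + X 0 * X 1 ^ 5 * X 2 + X 0 * X 1 * X 2 + X 1 ^ 4 : MvPolynomial (Fin 3) (ZMod 2)))) ∉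
      RingHom.ker (constantCoeff : MvPolynomial (Fin 3) (ZMod 2) →+* ZMod 2) := by
  rw [RingHom.mem_ker, W2_pderiv3_g]
  simp only [map_add, map_mul, map_pow, constantCoeff_X, map_ofNat, map_one]
  decide

/-- **DEAD-type certificate shape for `W2`, degrees `−1` and `−2`.** For EVERY family `P : ℕ → Ideal O` with
`g ∈ P 2` (`J ⊆ ℘(E,2)`), the sandwich negative module `sandwichPNega 2 1 P 2 a` (`m = 2`, `e = 1`) is NOT
contained in `𝔪_ξ` for `a = 1` and for `a = 2`: it contains `∂_y∂_{ω₁}∂_{ω₂} g = ω₁⁴ + 1`, the operator having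
order `3 ≤ d·m + a` (`d = 1`) relative to `ρ(O)`. [folklore] -/
theorem W2_not_sandwichPNega_le (P : ℕ → Ideal (MvPolynomial (Fin 3) (ZMod 2)))
    (hg : (X 0 ^ 2 + X 0 * X 1 ^ 5 * X 2 + X 0 * X 1 * X 2 + X 1 ^ 4 : MvPolynomial (Fin 3) (ZMod 2)) ∈ P 2)
    (a : ℕ) (ha : a = 1 ∨ a = 2) :
    ¬ sandwichPNega 2 1 P 2 a ≤ RingHom.ker (constantCoeff : MvPolynomial (Fin 3) (ZMod 2) →+* ZMod 2) := by
  obtain ⟨D, hD, hD'⟩ := exists_sandwich_pderiv3 (R := ZMod 2) (0 : Fin 3) 1 2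
  have hval := W2_pderiv3_g_not_mem
  rw [← hD'] at hval
  have hg' : (X 0 ^ 2 + X 0 * X 1 ^ 5 * X 2 + X 0 * X 1 * X 2 + X 1 ^ 4 : MvPolynomial (Fin 3) (ZMod 2)) ∈
      P (1 * 2) := by simpa using hg
  rcases ha with rfl | rfl
  · have hD1 : IsDiffOpLE (↥(iterateFrobenius (MvPolynomial (Fin 3) (ZMod 2)) 2 1).range) (1 * 2 + 1) D := by
      simpa using hD
    exact W12.not_sandwichPNega_le 2 1 P 2 1 1 (by norm_num) (by norm_num) hD1 hg' _ hval
  · have hD2 : IsDiffOpLE (↥(iterateFrobenius (MvPolynomial (Fin 3) (ZMod 2)) 2 1).range) (1 * 2 + 2) D := by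
      simpa using hD.mono
    exact W12.not_sandwichPNega_le 2 1 P 2 2 1 (by norm_num) (by norm_num) hD2 hg' _ hval

/-- Explicit membership: `∂_y∂_{ω₁}∂_{ω₂} g ∈ ℘nega_sandwich(W2,−1)`. [folklore] -/
theorem W2_pderiv3_g_mem (P : ℕ → Ideal (MvPolynomial (Fin 3) (ZMod 2)))
    (hg : (X 0 ^ 2 + X 0 * X 1 ^ 5 * X 2 + X 0 * X 1 * X 2 + X 1 ^ 4 : MvPolynomial (Fin 3) (ZMod 2)) ∈ P 2) :
    pderiv 0 (pderiv 1 (pderiv 2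
      (X 0 ^ 2 + X 0 * X 1 ^ 5 * X 2 + X 0 * X 1 * X 2 + X 1 ^ 4 : MvPolynomial (Fin 3) (ZMod 2)))) ∈
      sandwichPNega 2 1 P 2 1 := by
  obtain ⟨D, hD, hD'⟩ := exists_sandwich_pderiv3 (R := ZMod 2) (0 : Fin 3) 1 2
  have hg' : (X 0 ^ 2 + X 0 * X 1 ^ 5 * X 2 + X 0 * X 1 * X 2 + X 1 ^ 4 : MvPolynomial (Fin 3) (ZMod 2)) ∈
      P (1 * 2) := by simpa using hg
  have hD1 : IsDiffOpLE (↥(iterateFrobenius (MvPolynomial (Fin 3) (ZMod 2)) 2 1).range) (1 * 2 + 1) D := by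
    simpa using hD
  rw [← hD']
  exact W12.apply_mem_sandwichPNega 2 1 P 2 1 1 (by norm_num) (by norm_num) hD1 hg'

/-- **`℘nega_sandwich(W2,−1) + 𝔪_ξ = O`**: the module and the ideal of `ξ` are comaximal, so the module localised at
`ξ` is the unit ideal `O_ξ` («`T♯ ∋ 1`» at `ξ` in the sense of the K1.2 registration, for the sandwich reading,
degree `−1`). [folklore] -/
theorem W2_sandwichPNega_sup_eq_top (P : ℕ → Ideal (MvPolynomial (Fin 3) (ZMod 2)))
    (hg : (X 0 ^ 2 + X 0 * X 1 ^ 5 * X 2 + X 0 * X 1 * X 2 + X 1 ^ 4 : MvPolynomial (Fin 3) (ZMod 2)) ∈ P 2) :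
    sandwichPNega 2 1 P 2 1 ⊔ RingHom.ker (constantCoeff : MvPolynomial (Fin 3) (ZMod 2) →+* ZMod 2) = ⊤ := by
  by_contra h
  have heq := (ker_constantCoeff_isMaximal (Fin 3)).eq_of_le h le_sup_right
  refine W2_not_sandwichPNega_le P hg 1 (Or.inl rfl) ?_
  rw [heq]
  exact le_sup_left

end W2

end Summit.ResolutionOfSingularities.ResolutionOfSingularities.Theorems.Campaign.K11Repro

end
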